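import Summits.Ventures.HodgeRepro2.T6N41MainE
import Summits.Ventures.HodgeRepro2.T6N41Toy

/-!
# T6N41ToyE — non-vacuity witnesses for the faithful Hecke display and for `N41_mainE` (README §10.5(ii)(c)/(d))

On the toy datum `N41Toy.toyDatum` (one place, every L-function `≡ 1`) the faithful display
`Iwasawa2019_Sec3_1_EulerProductE` holds with NO primes at all (`κ = Empty`: the empty products are `1`), so every
binder of `N41_mainE` is instantiated simultaneously (`toy_N41E`).  §8(d): uses an L-value-free non-vanishing
device: NO.
-/

namespace Summit.Ventures.HodgeRepro2.T6
namespace N41Toy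

/-- Iwasawa §3.1 (E) holds on the toy with no primes (`κ = Empty`; empty products). -/
theorem toy_eulerE₁ : Hyp.Iwasawa2019_Sec3_1_EulerProductE toyDatum.L₁ toyDatum.g₁ := by
  refine ⟨Empty, fun e => e.elim, fun e => e.elim, fun e => e.elim, fun e => e.elim, fun e => e.elim,
    fun _ => Set.toFinite _, fun v s => ?_, fun s _ => ⟨summable_empty, ?_⟩⟩
  · have : IsEmpty {𝔓 : Empty // (fun e : Empty => e.elim) 𝔓 = v} := ⟨fun x => x.1.elim⟩
    simp [toyDatum]
  · simp [toyDatum]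

/-- Iwasawa §3.1 (E) holds on the toy for the second character as well. -/
theorem toy_eulerE₂ : Hyp.Iwasawa2019_Sec3_1_EulerProductE toyDatum.L₂ toyDatum.g₂ := toy_eulerE₁

/-- **(d) for `N41_mainE`:** on the toy every hypothesis of `N41_mainE` holds jointly. -/
theorem toy_N41E : toyDatum.R1 ∧ toyDatum.BothNontrivial :=
  N41Main.N41_mainE toyDatum ∅ toy_GQT toy_LR toy_padic toy_eulerE₁ toy_eulerE₂ toy_thm31₁ toy_thm31₂
    toy_prop44₁ toy_prop44₂ (fun _ h => (Finset.notMem_empty _ h).elim)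
    (fun _ h => (h (Finset.mem_univ _)).elim) toy_hloc

end N41Toy
end Summit.Ventures.HodgeRepro2.T6
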